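import Summits.Ventures.Crystal3D.Theorems.StickyWulffConstantTextureLiminfTexShadowLevelReachPlatesCut
import Summits.Ventures.Crystal3D.Theorems.StickyWulffConstantCoaxialWallLawPayerEndPairsMultiPlates
import HarnessLib

/-!
# Lane F's MULTI-ROOT plates census with per-root CUT sets: several root classes pooled, each cut at its own letters
# (lane T, crux `TextureLiminfV5`, stmt-Ventures-23912, registered stub `stub_terraceCensus`; (β)-lite × cut census — threading term, pooled)

HONEST FRAMING. Venture `Summits/Ventures/Crystal3D` (cell `crystal3d-full`), route `route-Ventures-StickyWulffConstant`, helper `--supports` the law-v5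
crux `TextureLiminfV5` (stmt-Ventures-23912), lane T (HOME/wall-p1-g22/BETA-CUT-g22.md §3/§5(1)).  Census-free, certificate-free; `KissingGap δ`,
`KissingClassification δ` BY NAME as in lane F's census; nothing about energies; F-C1 not moved.

THE POINT.  `word_endPairs_multi_plates` (…CoaxialWallLawPayerEndPairsMultiPlates, lane F) VERBATIM — roots `r ∈ RT` over one base frame, per-root invariants
`P r`, per-root core sources `srcOK r`, pooled typed end pairs `T` pairwise disjoint across roots by LEMMA X — with each family counted by the CUT plates census
`word_family_endPairs_plates_cuts` (…LevelReachPlatesCut p743337) at its own cut letters `C r` (`hC`: each crossed upward by the root `r`; `C r` may be empty).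
So the (β)-lite plate root budget can carry its five B1-safe classes UNCUT (`C r = ⊥`) together with the co-slot class CUT at both letters (`coSlot_endPairs_plates`'s
shape) in ONE pooled end set: **`word_endPairs_multi_plates_cuts`**: `Σ_r #{r-sources stepping into the window} ≤ #T + Σ_r #CUT_r + #RT·(220·#rim_top + 220·#rim_bot)`,
`hPcross r` needed only off the cut of `r`, `T` exported exactly as lane F's (`card_endPairs_le_of_localRow` / the certificate consume it).
WHAT THIS IS NOT: the Barlow discharge of the core hypotheses, any flux number, any certificate; F-C1 not moved.
-/
noncomputable section

namespace Summit.Ventures.Crystal3D.Theorems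

open Summit.Ventures.Crystal3D Finset
open Literature.MathematicalPhysics.StatisticalMechanics (fccStacking)
open scoped InnerProductSpace

section MultiRootPlatesCut

variable {X : Finset (EuclideanSpace ℝ (Fin 3))}
  {F : List (EuclideanSpace ℝ (Fin 3)) → (EuclideanSpace ℝ (Fin 3) ≃ₗᵢ[ℝ] EuclideanSpace ℝ (Fin 3))}
  {u : EuclideanSpace ℝ (Fin 3) → List (EuclideanSpace ℝ (Fin 3)) → EuclideanSpace ℝ (Fin 3)}
  {WF : EuclideanSpace ℝ (Fin 3) → List (EuclideanSpace ℝ (Fin 3)) → Prop}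
  {next : List (EuclideanSpace ℝ (Fin 3)) → EuclideanSpace ℝ (Fin 3) → List (EuclideanSpace ℝ (Fin 3))}
  {P' P₂ : Finset (EuclideanSpace ℝ (Fin 3))} {R₀ h ρ : ℝ}

open scoped Classical in
/-- **The multi-root plates census with per-root cut sets.**  Hypotheses VERBATIM from `word_endPairs_multi_plates` except the root-indexed cut predicate `C`
(`hC`) and `hPcross r` required only off the cut of `r`; conclusion = its conclusion plus `Σ_r #CUT_r`.  See the module docstring. -/
theorem word_endPairs_multi_plates_cuts (ver : WordVersion) {δ : ℝ} (hg : KissingGap δ) (hc : KissingClassification δ)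
    (hX : ∀ p ∈ X, ∀ q ∈ X, p ≠ q → 1 ≤ dist p q)
    (hFc : ∀ μ κ, F (μ :: κ) = ((ℝ ∙ μ)ᗮ.reflection).trans (F κ))
    (RT : Finset (EuclideanSpace ℝ (Fin 3))) (hRT : ∀ r ∈ RT, r ∈ fccSlots)
    (hu0 : ∀ r ∈ RT, u r [] = r) (huc : ∀ r ∈ RT, ∀ μ κ, u r (μ :: κ) = -u r κ)
    (hWF0 : ∀ r ∈ RT, WF r [])
    (hWFc : ∀ r ∈ RT, ∀ μ κ, WF r (μ :: κ) ↔ (WF r κ ∧ ‖μ‖ = 1 ∧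
      (∀ w ∈ fccSlots, ⟪w, μ⟫_ℝ = 0 ∨ ⟪w, μ⟫_ℝ = Real.sqrt (2 / 3) ∨ ⟪w, μ⟫_ℝ = -Real.sqrt (2 / 3)) ∧
      ⟪u r κ, μ⟫_ℝ = Real.sqrt (2 / 3) ∧ ∀ μ' κ', κ = μ' :: κ' → μ' ≠ -μ))
    (hnext_pop : ∀ μ κ' (m : EuclideanSpace ℝ (Fin 3)), (F (μ :: κ')).symm m = -μ → next (μ :: κ') m = κ')
    (hnext_push : ∀ κ (m : EuclideanSpace ℝ (Fin 3)), (∀ μ κ', κ = μ :: κ' → (F κ).symm m ≠ -μ) →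
      next κ m = (F κ).symm m :: κ)
    -- the root-indexed CUT letters, each crossed upward by its root
    (C : EuclideanSpace ℝ (Fin 3) → EuclideanSpace ℝ (Fin 3) → Prop) (hC : ∀ r ∈ RT, ∀ μ, C r μ → ⟪u r [], μ⟫_ℝ = Real.sqrt (2 / 3))
    -- the root-indexed state invariants (preserved by LEGAL moves off the cut)
    {P : EuclideanSpace ℝ (Fin 3) → EuclideanSpace ℝ (Fin 3) × List (EuclideanSpace ℝ (Fin 3)) → Prop}
    (hPstraight : ∀ r ∈ RT, ∀ (b : EuclideanSpace ℝ (Fin 3)) (κ : List (EuclideanSpace ℝ (Fin 3))), WF r κ →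
      (IsFull X (F κ) b ∨ (∃ m, IsTwinReading X (F κ) m b ∧ ⟪F κ (u r κ), m⟫_ℝ = 0) ∨
        (ver = WordVersion.v2 ∧ IsNarrow X (F κ) (F κ (u r κ)) b)) →
      P r (b, κ) → P r (b + F κ (u r κ), κ))
    (hPcross : ∀ r ∈ RT, ∀ (b : EuclideanSpace ℝ (Fin 3)) (κ : List (EuclideanSpace ℝ (Fin 3)))
      (m : EuclideanSpace ℝ (Fin 3)), WF r κ → WF r (next κ m) → IsTwinReading X (F κ) m b →
      ⟪F κ (u r κ), m⟫_ℝ = Real.sqrt (2 / 3) → (κ ≠ [] ∨ ¬ C r ((F []).symm m)) → P r (b, κ) →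
      P r (b + F (next κ m) (u r (next κ m)), next κ m))
    (hPexcl0 : ∀ r ∈ RT, ∀ (b : EuclideanSpace ℝ (Fin 3)) (κ : List (EuclideanSpace ℝ (Fin 3))), WF r κ → P r (b, κ) →
      b ∈ P₂ →
      (∃ a ∈ fccSlots, ∃ a' ∈ fccSlots, ∃ a'' ∈ fccSlots,
        ⟪a, a'⟫_ℝ = 1 / 2 ∧ ⟪a, a''⟫_ℝ = 1 / 2 ∧ ⟪a', a''⟫_ℝ = 1 / 2 ∧
        b + F κ a ∈ X ∧ b + F κ a' ∈ X ∧ b + F κ a'' ∈ X) → False)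
    (hup : ∀ r ∈ RT, 0 < (F [] r) 2)
    -- the cell
    (hR₀ : 3 ≤ R₀) (hρ : R₀ ≤ ρ)
    -- the bottom plate's CORE and its root-indexed SOURCES
    (srcOK : EuclideanSpace ℝ (Fin 3) → EuclideanSpace ℝ (Fin 3) → Prop)
    (hP'top : ∀ p ∈ P', p 2 ≤ -R₀ - 1)
    (hPsrc : ∀ r ∈ RT, ∀ p ∈ P', srcOK r p → p ∈ X ∧
      (∃ a ∈ fccSlots, ∃ a' ∈ fccSlots, ∃ a'' ∈ fccSlots,
        ⟪a, a'⟫_ℝ = 1 / 2 ∧ ⟪a, a''⟫_ℝ = 1 / 2 ∧ ⟪a', a''⟫_ℝ = 1 / 2 ∧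
        p + F [] a ∈ X ∧ p + F [] a' ∈ X ∧ p + F [] a'' ∈ X) ∧
      p - F [] r ∈ X ∧
      (IsFull X (F []) p ∨ (∃ m, IsTwinReading X (F []) m p ∧ ⟪F [] r, m⟫_ℝ = 0) ∨
        (ver = WordVersion.v2 ∧ IsNarrow X (F []) (F [] r) p)) ∧
      P r (p + F [] r, []))
    -- rigidity at the core: an `r`-class reading an occupied face at a core ball moves in the root direction
    (hstd : ∀ r ∈ RT, ∀ κ, WF r κ → ∀ p ∈ P', (∃ a ∈ fccSlots, ∃ a' ∈ fccSlots, ∃ a'' ∈ fccSlots,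
        ⟪a, a'⟫_ℝ = 1 / 2 ∧ ⟪a, a''⟫_ℝ = 1 / 2 ∧ ⟪a', a''⟫_ℝ = 1 / 2 ∧
        p + F κ a ∈ X ∧ p + F κ a' ∈ X ∧ p + F κ a'' ∈ X) → F κ (u r κ) = F [] r)
    -- sealing: below the window off the core, and above the window into the top plate
    (hsealB : ∀ s ∈ X, s ∉ P' → -R₀ - 1 - 1 ≤ s 2 → s 2 < -R₀ - 1 → s 0 ^ 2 + s 1 ^ 2 ≤ (ρ - 1) ^ 2 → False)
    (hP₂seal : ∀ s ∈ X, h + R₀ + 1 ≤ s 2 → s 2 ≤ h + R₀ + 1 + 1 → s 0 ^ 2 + s 1 ^ 2 ≤ (ρ - 2) ^ 2 → s ∈ P₂) :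
    ∃ T : Finset (EuclideanSpace ℝ (Fin 3) × EuclideanSpace ℝ (Fin 3)),
      ∑ r ∈ RT, (P'.filter fun p => srcOK r p ∧
          -R₀ - 1 < (p + F [] r) 2 ∧ (p + F [] r) 2 < h + R₀ + 1).card ≤
        T.card +
        ∑ r ∈ RT, (X.filter fun b => -R₀ - 1 ≤ b 2 ∧ b 2 < h + R₀ + 1 ∧ (∃ μ, C r μ ∧ IsTwinReading X (F []) (F [] μ) b) ∧
            P r (b, []) ∧ b - F [] r ∈ X).card + RT.card *
          (220 * (X.filter fun s => h + R₀ + 1 ≤ s 2 ∧ s 2 ≤ h + R₀ + 1 + 1 ∧ (ρ - 2) ^ 2 < s 0 ^ 2 + s 1 ^ 2).card +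
           220 * (X.filter fun s => -R₀ - 1 - 1 ≤ s 2 ∧ s 2 < -R₀ - 1 ∧ (ρ - 1) ^ 2 < s 0 ^ 2 + s 1 ^ 2).card) ∧
      (∀ bq ∈ T, bq.1 ∈ X ∧ bq.2 ∈ X ∧ dist bq.1 bq.2 = 1 ∧ -R₀ - 1 ≤ bq.1 2 ∧ bq.1 2 < h + R₀ + 1) ∧
      (∀ bq ∈ T, (X.filter fun q => dist bq.1 q = 1).card ≤ 11 ∨
        ∃ z₁ ∈ X, ∃ z₂ ∈ X, z₁ ≠ z₂ ∧ dist bq.1 z₁ = 1 ∧ dist bq.1 z₂ = 1 ∧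
          (X.filter fun q => dist z₁ q = 1).card ≤ 11 ∧ (X.filter fun q => dist z₂ q = 1).card ≤ 11) ∧
      (∀ bq ∈ T, ∃ r ∈ RT, (∃ κ, WF r κ ∧ P r (bq.1, κ)) ∧
        ∃ κ, WF r κ ∧ bq.2 - F κ (u r κ) ∈ X ∧ IsEndMove X ver (F κ) (F κ (u r κ)) bq.2 bq.1) := by
  set RIM : ℕ :=
    220 * (X.filter fun s => h + R₀ + 1 ≤ s 2 ∧ s 2 ≤ h + R₀ + 1 + 1 ∧ (ρ - 2) ^ 2 < s 0 ^ 2 + s 1 ^ 2).card +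
      220 * (X.filter fun s => -R₀ - 1 - 1 ≤ s 2 ∧ s 2 < -R₀ - 1 ∧ (ρ - 1) ^ 2 < s 0 ^ 2 + s 1 ^ 2).card with hRIM
  set CUT : EuclideanSpace ℝ (Fin 3) → ℕ := fun r => (X.filter fun b => -R₀ - 1 ≤ b 2 ∧ b 2 < h + R₀ + 1 ∧
    (∃ μ, C r μ ∧ IsTwinReading X (F []) (F [] μ) b) ∧ P r (b, []) ∧ b - F [] r ∈ X).card with hCUT
  -- the per-family end pairs, each family with its own invariant `P r` and its own sources `srcOK r`
  have hfam : ∀ r ∈ RT, ∃ T : Finset (EuclideanSpace ℝ (Fin 3) × EuclideanSpace ℝ (Fin 3)),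
      (P'.filter fun p => srcOK r p ∧
          -R₀ - 1 < (p + F [] r) 2 ∧ (p + F [] r) 2 < h + R₀ + 1).card ≤ T.card + CUT r + RIM ∧
      (∀ bq ∈ T, bq.1 ∈ X ∧ bq.2 ∈ X ∧ dist bq.1 bq.2 = 1 ∧ -R₀ - 1 ≤ bq.1 2 ∧ bq.1 2 < h + R₀ + 1) ∧
      (∀ bq ∈ T, (X.filter fun q => dist bq.1 q = 1).card ≤ 11 ∨
        ∃ z₁ ∈ X, ∃ z₂ ∈ X, z₁ ≠ z₂ ∧ dist bq.1 z₁ = 1 ∧ dist bq.1 z₂ = 1 ∧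
          (X.filter fun q => dist z₁ q = 1).card ≤ 11 ∧ (X.filter fun q => dist z₂ q = 1).card ≤ 11) ∧
      (∀ bq ∈ T, ∃ κ, WF r κ ∧ P r (bq.1, κ)) ∧
      (∀ bq ∈ T, ∃ κ, WF r κ ∧ bq.2 - F κ (u r κ) ∈ X ∧ IsEndMove X ver (F κ) (F κ (u r κ)) bq.2 bq.1) := by
    intro r hr
    have hur : ∀ κ, u r κ ∈ fccSlots := word_u_mem (hRT r hr) (hu0 r hr) (huc r hr)
    have hup' : 0 < (F [] (u r [])) 2 := by rw [hu0 r hr]; exact hup r hr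
    have hPsrc' : ∀ p ∈ P', srcOK r p → p ∈ X ∧
        (∃ a ∈ fccSlots, ∃ a' ∈ fccSlots, ∃ a'' ∈ fccSlots,
          ⟪a, a'⟫_ℝ = 1 / 2 ∧ ⟪a, a''⟫_ℝ = 1 / 2 ∧ ⟪a', a''⟫_ℝ = 1 / 2 ∧
          p + F [] a ∈ X ∧ p + F [] a' ∈ X ∧ p + F [] a'' ∈ X) ∧
        p - F [] (u r []) ∈ X ∧
        (IsFull X (F []) p ∨ (∃ m, IsTwinReading X (F []) m p ∧ ⟪F [] (u r []), m⟫_ℝ = 0) ∨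
          (ver = WordVersion.v2 ∧ IsNarrow X (F []) (F [] (u r [])) p)) ∧
        P r (p + F [] (u r []), []) := by rw [hu0 r hr]; exact hPsrc r hr
    have hstd' : ∀ κ, WF r κ → ∀ p ∈ P', (∃ a ∈ fccSlots, ∃ a' ∈ fccSlots, ∃ a'' ∈ fccSlots,
        ⟪a, a'⟫_ℝ = 1 / 2 ∧ ⟪a, a''⟫_ℝ = 1 / 2 ∧ ⟪a', a''⟫_ℝ = 1 / 2 ∧
        p + F κ a ∈ X ∧ p + F κ a' ∈ X ∧ p + F κ a'' ∈ X) → F κ (u r κ) = F [] (u r []) := by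
      rw [hu0 r hr]; exact hstd r hr
    have hC' : ∀ μ, C r μ → ⟪u r [], μ⟫_ℝ = Real.sqrt (2 / 3) := hC r hr
    obtain ⟨T, hkey, hT, hpay, hinv, hwit⟩ := word_family_endPairs_plates_cuts ver (F := F) (u := u r) (WF := WF r)
      (next := next) (P := P r) hg hc hX hFc hur (huc r hr) (hWF0 r hr) (hWFc r hr)
      hnext_pop hnext_push (C r) hC' (hPstraight r hr) (hPcross r hr) (hPexcl0 r hr) hup' hR₀ hρ (srcOK r) hP'top hPsrc' hstd'
      hsealB hP₂seal
    rw [hu0 r hr] at hkey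
    exact ⟨T, by rw [hCUT, hRIM]; linarith [hkey], hT, hpay, hinv, hwit⟩
  choose! Tf hTkey hTpair hTpay hTinv hTwit using hfam
  -- pairwise disjointness across roots: LEMMA X (shape form)
  have hdisj : ∀ r ∈ RT, ∀ r' ∈ RT, r ≠ r' → Disjoint (Tf r) (Tf r') := by
    intro r hr r' hr' hrr'
    rw [Finset.disjoint_left]
    intro bq hbq hbq'
    obtain ⟨κ, hκ, -, hmove⟩ := hTwit r hr bq hbq
    obtain ⟨κ', hκ', -, hmove'⟩ := hTwit r' hr' bq hbq'
    obtain ⟨hlet, hch⟩ := word_letters_of_wf (huc r hr) (hWFc r hr) κ hκ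
    obtain ⟨hlet', hch'⟩ := word_letters_of_wf (huc r' hr') (hWFc r' hr') κ' hκ'
    have hob := word_letters_oblique_of_wf (huc r hr) (hWFc r hr) κ hκ
    have hob' := word_letters_oblique_of_wf (huc r' hr') (hWFc r' hr') κ' hκ'
    rw [hu0 r hr] at hob
    rw [hu0 r' hr'] at hob'
    have hne' : r ≠ -r' := by
      intro h
      have h1 := hup r hr
      have h2 := hup r' hr'
      rw [h, map_neg, PiLp.neg_apply] at h1
      linarith
    have hd : F κ (u r κ) = F κ (((-1 : ℝ) ^ κ.length) • r) := by rw [word_u_eq_pow (huc r hr) κ, hu0 r hr]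
    have hd' : F κ' (u r' κ') = F κ' (((-1 : ℝ) ^ κ'.length) • r') := by
      rw [word_u_eq_pow (huc r' hr') κ', hu0 r' hr']
    exact word_target_ne_of_roots_ne_shape hFc hlet hlet' hch hch' (hRT r hr) (hRT r' hr') hrr' hne' hob hob'
      (neg_one_pow_eq_or ℝ κ.length) (neg_one_pow_eq_or ℝ κ'.length) hd hd'
      (shape_of_isEndMove hmove) (shape_of_isEndMove hmove') rfl
  -- export the pooled pair set
  refine ⟨RT.biUnion Tf, ?_, ?_, ?_, ?_⟩
  · rw [card_biUnion hdisj]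
    calc ∑ r ∈ RT, (P'.filter fun p => srcOK r p ∧
            -R₀ - 1 < (p + F [] r) 2 ∧ (p + F [] r) 2 < h + R₀ + 1).card
        ≤ ∑ r ∈ RT, ((Tf r).card + CUT r + RIM) := sum_le_sum fun r hr => hTkey r hr
      _ = ∑ r ∈ RT, (Tf r).card + ∑ r ∈ RT, CUT r + RT.card * RIM := by
          rw [sum_add_distrib, sum_add_distrib, sum_const, smul_eq_mul]
      _ ≤ _ := by rw [hCUT, hRIM]
  · intro bq hbq
    obtain ⟨r, hr, hbqr⟩ := mem_biUnion.1 hbq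
    exact hTpair r hr bq hbqr
  · intro bq hbq
    obtain ⟨r, hr, hbqr⟩ := mem_biUnion.1 hbq
    exact hTpay r hr bq hbqr
  · intro bq hbq
    obtain ⟨r, hr, hbqr⟩ := mem_biUnion.1 hbq
    exact ⟨r, hr, hTinv r hr bq hbqr, hTwit r hr bq hbqr⟩

end MultiRootPlatesCut

end Summit.Ventures.Crystal3D.Theorems

end
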